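/-
Copyright (c) 2026 the pub-hodgecm-mathlib formalisation cell (harness21).  Prover seat hodgecm-mathlib-B-p14 (g36): road «S3-tree» (chair F0P3a-plan (g11); T10-42 (3) S3-res capital),
brick T1e «VALENCIES», DATUM-FREE EDITION R2b = the count of the star of a self-dual vertex for ANY involution; the TAME RAMIFIED valency `q + 1`; 2026-09-01.  Twin of ★ V2b.
-/
import Literature.NumberTheory.Automorphic.UnitaryLatticeTreeRootStarOrbitOfInvolution   -- ★ T1e R2a (B-p14 (g36)): datum-free star(L₀) = K₀·N₁
import Literature.NumberTheory.Automorphic.UnitaryLatticeTreeRootStarCount               -- ★ T1e V2b (B-p14 (g36)): `vec_mem_stdLattice`, separation lemmas, `v_B₀_vec_self_lt_one` (datum-free parts reused)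
import HarnessLib

/-!
# The lattice graph of a hermitian space — T1e FILE R2b: THE STAR OF A SELF-DUAL VERTEX FOR ANY INVOLUTION — `#star = 1 + #{(ā,b̄) : b̄ + σk b̄ + ā σk ā = 0}` for every reduction
# `σk`; at a TAME RAMIFIED place (`σk = id`, `2 ∈ 𝓀^×`) the points of the residual CONIC give the valency `q + 1` (Tits 1979 §2.4; Bruhat–Tits 1972 §10; Serre II.1.1)

Topic `NumberTheory/Automorphic`; namespace `Literature.NumberTheory.Automorphic.UnitaryLatticeTree`.  THEOREMS ONLY (no definition, no instance, no notation, no named fact,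
no `sorry`); kernel lane.  Cell `pub/hodgecm-mathlib` (D-0151), crux H413 = `stmt-HodgeConjecture-24833`; road «S3-tree», brick T1e «VALENCIES», DATUM-FREE EDITION (S3-res capital,
chair T10-42 (3)).  ★ V2b `UnitaryLatticeTreeRootStarCount` proves `#star(L₀) = #(Option {(ā,b̄) | b̄ + σk b̄ + ā σk ā = 0})` under the unramified datum and then `= q³ + 1` for the
Frobenius; its bijection uses the datum only through `|σ·| = |·|` and the V2a inputs.  Here (§1–§2) the same bijection under `(hσ) (hvσ) (hϖ) (htrace) (hN₁)` for ANY reduction `σk`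
of `σ`, and (§3) the TAME RAMIFIED specialisation: `hres : |σx − x| < 1` on `𝒪` makes `σk = id` a reduction, `|2| = 1` gives the trace element `½` (★ `exists_traceElem_of_v_two_eq_one`)
and `2 ∈ 𝓀^×`, the parameter set `{(ā,b̄) | 2b̄ + ā² = 0}` is the affine CONIC `b̄ = −ā²∕2` ≃ `𝓀`, so **every self-dual vertex of the tame-ramified `U(3)` tree has exactly
`q + 1` neighbours**, `q = |𝓀|` (the residue field of `K` itself — at a ramified place `𝓀_E = 𝓀_F`).

* §1 `exists_unit_congr_normalForm_of_isotropic_of_v` (V2b §2 with `hd.vσ ↦ hvσ`).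
* §2 **`natCard_neighborSet_root_eq_of_trace`** (V2b §3, datum-free), `finite_neighborSet_root_of_trace`, `finite_neighborSet_of_isSelfDualLattice_of_trace`.
* §3 `natCard_conicParams_eq` (`#{(a,b) : b + b + a·a = 0} = #𝓀` for `2 ≠ 0`), **`ncard_neighborSet_root_of_ramified`**, **`ncard_neighborSet_of_isSelfDualLattice_of_ramified`** (`= Nat.card 𝓀[K] + 1`).

HONEST LABEL: HC_CM is proved only modulo the 2 remaining named inputs (hLiu418 24832, h413 24833) until rung 0 closes; nothing printed is asserted here; ramified places belong to
the residue letter S3-res.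

## References
* [Tits1979] J. Tits, *Reductive groups over local fields*, PSPM 33.1 (1979), §2.4 (ramified quasi-split `U(3)`: local index `(q+1, q+1)`), §3.5.
* [BruhatTits1972] F. Bruhat, J. Tits, *Groupes réductifs sur un corps local I*, Publ. Math. IHÉS 41 (1972), §10.
* [Serre1980Trees] J.-P. Serre, *Trees* (1980), Ch. II §1.1.
* [Jacobowitz1962] R. Jacobowitz, *Hermitian forms over local fields*, Amer. J. Math. 84 (1962), §7–§8.
-/

set_option autoImplicit false

noncomputable section

open scoped Valued WithZero Matrix MatrixGroups

namespace Literature.NumberTheory.Automorphic.UnitaryLatticeTree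

open Literature.NumberTheory.Automorphic Literature.NumberTheory.Automorphic.HermitianLattice
open Literature.NumberTheory.Automorphic.CartanUnique

variable {K : Type*} [Field K] [Valued K ℤᵐ⁰] {σ : K →+* K} {ϖ : K}

/-! ## §1 The normalised representative (any `σ` preserving `v`) -/

/-- **NORMAL FORM OF AN ISOTROPIC POINT.**  Let `x ∈ 𝒪³` be primitive and exactly isotropic (`B₀ x x = 0`), and let `lift` be any section of the residue map.  Then EITHER `|x₀| < 1`,
and `x ≡ x₂·e₂ (mod 𝔪)` with `|x₂| = 1` (isotropy forces `|x₁| < 1`), OR `|x₀| = 1`, and with `A = x₁∕x₀`, `B = x₂∕x₀` one has `B + σB + AσA = 0`, so the residue pair `(Ā, B̄)`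
satisfies `B̄ + σk B̄ + Ā σk Ā = 0` and `x ≡ x₀·(1, lift Ā, lift B̄) (mod 𝔪)`. [cite: Tits1979, §3.5] [cite: Serre1980Trees, II.1.1] [cite: Wilson2009, §3.6.2] -/
theorem exists_unit_congr_normalForm_of_isotropic_of_v (hvσ : ∀ a, Valued.v (σ a) = Valued.v a) (hσO : ∀ x : 𝒪[K], σ x ∈ 𝒪[K]) (σk : 𝓀[K] →+* 𝓀[K])
    (hσk : ∀ x : 𝒪[K], IsLocalRing.residue 𝒪[K] ⟨σ x, hσO x⟩ = σk (IsLocalRing.residue 𝒪[K] x))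
    (lift : 𝓀[K] → 𝒪[K]) (hlift : ∀ a, IsLocalRing.residue 𝒪[K] (lift a) = a)
    {x : Fin 3 → K} (hx : x ∈ stdLattice K 3) (hunit : ∃ j, Valued.v (x j) = 1) (hiso : B₀ σ 3 x x = 0) :
    (∃ c : K, Valued.v c = 1 ∧ ∀ i, Valued.v (x i - c * (Pi.single 2 1 : Fin 3 → K) i) < 1) ∨
      ∃ p : {p : 𝓀[K] × 𝓀[K] // p.2 + σk p.2 + p.1 * σk p.1 = 0}, ∃ c : K, Valued.v c = 1 ∧
        ∀ i, Valued.v (x i - c * (![(1 : K), (lift p.1.1 : K), (lift p.1.2 : K)] : Fin 3 → K) i) < 1 := by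
  have h0 : Valued.v (0 : K) < 1 := by rw [map_zero]; exact zero_lt_one
  by_cases hx0 : Valued.v (x 0) = 1
  · -- `|x₀| = 1`: `x = x₀ · (1, A, B)`
    right
    have hx0' : x 0 ≠ 0 := fun h => by rw [h, map_zero] at hx0; exact zero_ne_one hx0
    have hσx0 : σ (x 0) ≠ 0 := (map_ne_zero σ).2 hx0'
    have hA : Valued.v (x 1 / x 0) ≤ 1 := by rw [map_div₀, hx0, div_one]; exact hx 1
    have hB : Valued.v (x 2 / x 0) ≤ 1 := by rw [map_div₀, hx0, div_one]; exact hx 2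
    set A : 𝒪[K] := ⟨x 1 / x 0, hA⟩ with hAdef
    set B : 𝒪[K] := ⟨x 2 / x 0, hB⟩ with hBdef
    -- exact isotropy in the normalised coordinates
    have hEq : (B : K) + σ (B : K) + (A : K) * σ (A : K) = 0 := by
      have hiso' : σ (x 0) * x 2 + σ (x 1) * x 1 + σ (x 2) * x 0 = 0 := by rw [← UnitaryGroup.B₀_three_apply]; exact hiso
      change x 2 / x 0 + σ (x 2 / x 0) + x 1 / x 0 * σ (x 1 / x 0) = 0
      rw [map_div₀, map_div₀]
      field_simp
      linear_combination hiso'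
    -- the residue pair
    have hE0 : (B + ⟨σ (B : K), hσO B⟩ + A * ⟨σ (A : K), hσO A⟩ : 𝒪[K]) = 0 := Subtype.ext (by simpa using hEq)
    have hres : IsLocalRing.residue 𝒪[K] B + σk (IsLocalRing.residue 𝒪[K] B) + IsLocalRing.residue 𝒪[K] A * σk (IsLocalRing.residue 𝒪[K] A) = 0 := by
      rw [← hσk, ← hσk, ← map_mul, ← map_add, ← map_add, hE0, map_zero]
    refine ⟨⟨(IsLocalRing.residue 𝒪[K] A, IsLocalRing.residue 𝒪[K] B), hres⟩, x 0, hx0, fun i => ?_⟩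
    -- the congruence `x ≡ x₀ · (1, lift Ā, lift B̄)`
    have hcongr : ∀ (C : 𝒪[K]), Valued.v ((C : K) - (lift (IsLocalRing.residue 𝒪[K] C) : K)) < 1 := fun C => by
      rw [← coe_sub_eq, ← residue_eq_zero_iff_v_lt_one, map_sub, hlift, sub_self]
    fin_cases i
    · simp
    · have e : x 1 - x 0 * (lift (IsLocalRing.residue 𝒪[K] A) : K) = x 0 * ((A : K) - (lift (IsLocalRing.residue 𝒪[K] A) : K)) := by
        change x 1 - x 0 * _ = x 0 * (x 1 / x 0 - _)
        field_simp
      simp only [Fin.mk_one, Matrix.cons_val_one, Matrix.cons_val_zero]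
      rw [e, map_mul, hx0, one_mul]
      exact hcongr A
    · have e : x 2 - x 0 * (lift (IsLocalRing.residue 𝒪[K] B) : K) = x 0 * ((B : K) - (lift (IsLocalRing.residue 𝒪[K] B) : K)) := by
        change x 2 - x 0 * _ = x 0 * (x 2 / x 0 - _)
        field_simp
      simp only [Fin.reduceFinMk, Matrix.cons_val_two, Matrix.tail_cons, Matrix.head_cons]
      rw [e, map_mul, hx0, one_mul]
      exact hcongr B
  · -- `|x₀| < 1`: isotropy forces `|x₁| < 1`, so `|x₂| = 1` and `x ≡ x₂ · e₂`
    left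
    have hx0lt : Valued.v (x 0) < 1 := lt_of_le_of_ne (hx 0) hx0
    have hx1 : Valued.v (x 1) < 1 := by
      have h : σ (x 1) * x 1 = -(σ (x 0) * x 2 + σ (x 2) * x 0) := by
        rw [UnitaryGroup.B₀_three_apply] at hiso
        linear_combination hiso
      have hv : Valued.v (σ (x 1) * x 1) < 1 := by
        rw [h, Valuation.map_neg]
        refine (Valuation.map_add _ _ _).trans_lt (max_lt ?_ ?_)
        · rw [map_mul, hvσ]
          calc Valued.v (x 0) * Valued.v (x 2) ≤ Valued.v (x 0) * 1 := mul_le_mul_right (hx 2) _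
            _ < 1 := by rw [mul_one]; exact hx0lt
        · rw [map_mul, hvσ]
          calc Valued.v (x 2) * Valued.v (x 0) ≤ 1 * Valued.v (x 0) := mul_le_mul_left (hx 2) _
            _ < 1 := by rw [one_mul]; exact hx0lt
      rw [map_mul, hvσ] at hv
      by_contra hge
      have h1 : Valued.v (x 1) = 1 := le_antisymm (hx 1) (not_lt.1 hge)
      rw [h1, mul_one] at hv
      exact lt_irrefl _ hv
    have hx2 : Valued.v (x 2) = 1 := by
      obtain ⟨j, hj⟩ := hunit
      fin_cases j
      · exact absurd hj hx0
      · exact absurd hj hx1.ne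
      · exact hj
    refine ⟨x 2, hx2, fun i => ?_⟩
    fin_cases i
    · simpa using hx0lt
    · simpa using hx1
    · simp

/-! ## §2 The bijection with the normalised residual parameters (any involution with a trace element, any reduction `σk`) -/

/-- **THE STAR OF THE ROOT ↔ THE ISOTROPIC POINTS OF `(𝓀³, B̄₀)`, NORMALISED**: `#star(L₀) = #(Option {(ā, b̄) ∈ 𝓀² | b̄ + σk b̄ + ā σk ā = 0})` — the point at infinity `[0:0:1]`
(the neighbour `N_{e₂}`) and the affine isotropic points `[1:ā:b̄]` (the neighbours `N_{(1,A,B)}`).  Valid for ANY residue field and any reduction `σk` of `σ`.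
[cite: BruhatTits1972, §10] [cite: Tits1979, §3.5] [cite: Serre1980Trees, II.1.1] -/
theorem natCard_neighborSet_root_eq_of_trace (hσ : ∀ x, σ (σ x) = x) (hvσ : ∀ a, Valued.v (σ a) = Valued.v a) (hϖ : Valued.v ϖ = WithZero.exp (-1 : ℤ)) (htrace : ∃ t : K, Valued.v t ≤ 1 ∧ t + σ t = 1) (hN₁ : IsVertexLattice σ ϖ ((StdForm.antidiagonal 3).over K) 2 (latt (Matrix.diagonal ![(1 : K), 1, ϖ]))) (hσO : ∀ x : 𝒪[K], σ x ∈ 𝒪[K]) (σk : 𝓀[K] →+* 𝓀[K])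
    (hσk : ∀ x : 𝒪[K], IsLocalRing.residue 𝒪[K] ⟨σ x, hσO x⟩ = σk (IsLocalRing.residue 𝒪[K] x)) :
    Nat.card ((latticeGraph σ ϖ ((StdForm.antidiagonal 3).over K)).neighborSet ⟨stdLattice K 3, 0, isSelfDualLattice_stdLattice_three_of_v hϖ⟩) =
      Nat.card (Option {p : 𝓀[K] × 𝓀[K] // p.2 + σk p.2 + p.1 * σk p.1 = 0}) := by
  classical
  -- a section of the residue map and the normalised vectors
  obtain ⟨lift, hlift⟩ : ∃ lift : 𝓀[K] → 𝒪[K], ∀ a, IsLocalRing.residue 𝒪[K] (lift a) = a :=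
    ⟨Function.surjInv IsLocalRing.residue_surjective, Function.surjInv_eq IsLocalRing.residue_surjective⟩
  let xOf : Option {p : 𝓀[K] × 𝓀[K] // p.2 + σk p.2 + p.1 * σk p.1 = 0} → (Fin 3 → K) := fun p =>
    p.elim (Pi.single 2 1) fun q => ![(1 : K), (lift q.1.1 : K), (lift q.1.2 : K)]
  have hxOf_none : xOf none = Pi.single 2 1 := rfl
  have hxOf_some : ∀ q, xOf (some q) = ![(1 : K), (lift q.1.1 : K), (lift q.1.2 : K)] := fun _ => rfl
  have hxL : ∀ p, xOf p ∈ stdLattice K 3 := by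
    rintro (_ | q)
    · rw [hxOf_none]; exact single_mem_stdLattice 2
    · rw [hxOf_some]; exact vec_mem_stdLattice _ _
  have hxu : ∀ p, ∃ j, Valued.v (xOf p j) = 1 := by
    rintro (_ | q)
    · exact ⟨2, by rw [hxOf_none]; simp⟩
    · exact ⟨0, by rw [hxOf_some]; simp⟩
  have hxiso : ∀ p, Valued.v (B₀ σ 3 (xOf p) (xOf p)) < 1 := by
    rintro (_ | q)
    · rw [hxOf_none, B₀_single_left, show Fin.rev (2 : Fin 3) = 0 from rfl]; simp
    · rw [hxOf_some]
      refine v_B₀_vec_self_lt_one hσO σk hσk ?_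
      rw [hlift, hlift]; exact q.2
  -- the vertices `N_{x_p}`
  choose f hf using fun p => exists_mem_neighborSet_root_forall_mem_iff_of_trace hσ hvσ hϖ htrace hN₁ (hxL p) (hxu p) (hxiso p)
  -- hyperplane membership of `𝒪³`-vectors, read off `f`
  have hfiff : ∀ p, ∀ y ∈ stdLattice K 3, (y ∈ (f p).1 ↔ Valued.v (B₀ σ 3 (xOf p) y) < 1) := fun p y hy => by
    rw [(hf p).2 y]; exact ⟨fun h => h.2, fun h => ⟨hy, h⟩⟩
  refine (Nat.card_congr (Equiv.ofBijective (fun p => (⟨f p, (hf p).1⟩ :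
    (latticeGraph σ ϖ ((StdForm.antidiagonal 3).over K)).neighborSet ⟨stdLattice K 3, 0, isSelfDualLattice_stdLattice_three_of_v hϖ⟩)) ⟨?_, ?_⟩)).symm
  · -- injective: equal hyperplanes ⇒ equal normalised parameters
    intro p p' hpp'
    have hEq : f p = f p' := congrArg Subtype.val hpp'
    have hiff : ∀ y ∈ stdLattice K 3, (Valued.v (B₀ σ 3 (xOf p) y) < 1 ↔ Valued.v (B₀ σ 3 (xOf p') y) < 1) := fun y hy => by
      rw [← hfiff p y hy, ← hfiff p' y hy, hEq]
    rcases p with _ | ⟨⟨a, b⟩, hab⟩ <;> rcases p' with _ | ⟨⟨a', b'⟩, hab'⟩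
    · rfl
    · exact absurd hiff (by rw [hxOf_none, hxOf_some]; exact not_forall_v_B₀_single_iff_vec hvσ _ _)
    · refine absurd (fun y hy => (hiff y hy).symm) ?_
      rw [hxOf_none, hxOf_some]; exact not_forall_v_B₀_single_iff_vec hvσ _ _
    · rw [hxOf_some, hxOf_some] at hiff
      obtain ⟨ha, hb⟩ := residue_eq_of_forall_v_B₀_vec_iff hvσ hiff
      simp only [hlift] at ha hb
      subst ha hb
      rfl
  · -- surjective: every vertex of the star is the hyperplane of a normalised vector
    rintro ⟨w, hw⟩
    obtain ⟨x, hx, hunit, hiso, hmem⟩ := exists_isotropic_forall_mem_iff_of_mem_neighborSet_root_of_trace hσ hvσ hϖ htrace hN₁ hw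
    have key : ∀ p, (∃ c : K, Valued.v c = 1 ∧ ∀ i, Valued.v (x i - c * xOf p i) < 1) → f p = w := fun p hc => by
      refine eq_of_forall_mem_iff fun y => ?_
      rw [(hf p).2 y, hmem y]
      exact and_congr_right fun hy => (forall_v_B₀_lt_one_iff_of_exists_unit_congr hvσ hc y hy).symm
    rcases exists_unit_congr_normalForm_of_isotropic_of_v hvσ hσO σk hσk lift hlift hx hunit hiso with hc | ⟨p, hc⟩
    · exact ⟨none, Subtype.ext (key none (by rw [hxOf_none]; exact hc))⟩
    · exact ⟨some p, Subtype.ext (key (some p) (by rw [hxOf_some]; exact hc))⟩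

/-- **The star of the root is finite** — any involution with a trace element, finite residue field, ANY reduction `σk` (one always exists for valuation-preserving `σ`). [cite: BruhatTits1972, §10] -/
theorem finite_neighborSet_root_of_trace (hσ : ∀ x, σ (σ x) = x) (hvσ : ∀ a, Valued.v (σ a) = Valued.v a) (hϖ : Valued.v ϖ = WithZero.exp (-1 : ℤ)) (htrace : ∃ t : K, Valued.v t ≤ 1 ∧ t + σ t = 1) (hN₁ : IsVertexLattice σ ϖ ((StdForm.antidiagonal 3).over K) 2 (latt (Matrix.diagonal ![(1 : K), 1, ϖ]))) (hσO : ∀ x : 𝒪[K], σ x ∈ 𝒪[K]) (σk : 𝓀[K] →+* 𝓀[K])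
    (hσk : ∀ x : 𝒪[K], IsLocalRing.residue 𝒪[K] ⟨σ x, hσO x⟩ = σk (IsLocalRing.residue 𝒪[K] x)) [Finite 𝓀[K]] :
    ((latticeGraph σ ϖ ((StdForm.antidiagonal 3).over K)).neighborSet ⟨stdLattice K 3, 0, isSelfDualLattice_stdLattice_three_of_v hϖ⟩).Finite := by
  have h := natCard_neighborSet_root_eq_of_trace hσ hvσ hϖ htrace hN₁ hσO σk hσk
  rw [Finite.card_option] at h
  exact Set.finite_coe_iff.1 (Nat.finite_of_card_ne_zero (by rw [h]; exact Nat.succ_ne_zero _))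

/-- **The star of every self-dual vertex is finite** (any involution with a trace element and a reduction; finite residue field). [cite: BruhatTits1972, §10] -/
theorem finite_neighborSet_of_isSelfDualLattice_of_trace (hσ : ∀ x, σ (σ x) = x) (hvσ : ∀ a, Valued.v (σ a) = Valued.v a) (hϖ : Valued.v ϖ = WithZero.exp (-1 : ℤ)) (htrace : ∃ t : K, Valued.v t ≤ 1 ∧ t + σ t = 1) (hN₁ : IsVertexLattice σ ϖ ((StdForm.antidiagonal 3).over K) 2 (latt (Matrix.diagonal ![(1 : K), 1, ϖ]))) (hσO : ∀ x : 𝒪[K], σ x ∈ 𝒪[K]) (σk : 𝓀[K] →+* 𝓀[K])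
    (hσk : ∀ x : 𝒪[K], IsLocalRing.residue 𝒪[K] ⟨σ x, hσO x⟩ = σk (IsLocalRing.residue 𝒪[K] x)) [Finite 𝓀[K]]
    (v : {M : Submodule 𝒪[K] (Fin 3 → K) // IsVertex σ ϖ ((StdForm.antidiagonal 3).over K) M}) (hv : IsSelfDualLattice σ ϖ ((StdForm.antidiagonal 3).over K) v.1) :
    ((latticeGraph σ ϖ ((StdForm.antidiagonal 3).over K)).neighborSet v).Finite :=
  (finite_neighborSet_iff_root_of_trace hσ hvσ hϖ htrace v hv).2 (finite_neighborSet_root_of_trace hσ hvσ hϖ htrace hN₁ hσO σk hσk)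

/-! ## §3 The tame ramified place: `σk = id`, the residual conic, valency `q + 1` -/

/-- **The affine conic `2b + a² = 0` over a field with `2 ≠ 0` has exactly `|k|` points** (`b = −a²∕2`). [cite: Tits1979, §2.4] -/
theorem natCard_conicParams_eq {k : Type*} [Field k] (h2 : (2 : k) ≠ 0) :
    Nat.card {p : k × k // p.2 + (RingHom.id k) p.2 + p.1 * (RingHom.id k) p.1 = 0} = Nat.card k := by
  refine Nat.card_congr
    { toFun := fun p => p.1.1
      invFun := fun a => ⟨(a, -(a * a) / 2), by simp only [RingHom.id_apply]; field_simp; ring⟩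
      left_inv := fun p => ?_
      right_inv := fun a => rfl }
  obtain ⟨⟨a, b⟩, hab⟩ := p
  simp only [RingHom.id_apply] at hab
  apply Subtype.ext
  simp only [Prod.mk.injEq, true_and]
  rw [div_eq_iff h2]
  linear_combination (-1 : k) * hab

/-- **AT A TAME RAMIFIED PLACE THE STAR OF THE ROOT HAS `q + 1` VERTICES** (`σ` an involution preserving `v` that acts TRIVIALLY on the residue field — `hres` —, `|2| = 1`, finite residue
field of order `q`; `hN₁` from ★ `isVertexLattice_two_N₁_of_neg` when `σϖ = −ϖ`): the points `[0:0:1]`, `[1:a:−a²∕2]` of the residual conic `2x₀x₂ + x₁² = 0`. [cite: Tits1979, §2.4] [cite: BruhatTits1972, §10] -/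
theorem ncard_neighborSet_root_of_ramified (hσ : ∀ x, σ (σ x) = x) (hvσ : ∀ a, Valued.v (σ a) = Valued.v a) (hϖ : Valued.v ϖ = WithZero.exp (-1 : ℤ))
    (hres : ∀ x : K, Valued.v x ≤ 1 → Valued.v (σ x - x) < 1) (h2 : Valued.v (2 : K) = 1)
    (hN₁ : IsVertexLattice σ ϖ ((StdForm.antidiagonal 3).over K) 2 (latt (Matrix.diagonal ![(1 : K), 1, ϖ]))) [Finite 𝓀[K]] :
    ((latticeGraph σ ϖ ((StdForm.antidiagonal 3).over K)).neighborSet ⟨stdLattice K 3, 0, isSelfDualLattice_stdLattice_three_of_v hϖ⟩).ncard = Nat.card 𝓀[K] + 1 := by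
  have hσO : ∀ x : 𝒪[K], σ x ∈ 𝒪[K] := fun x => by change Valued.v (σ x) ≤ 1; rw [hvσ]; exact x.2
  have hσk : ∀ x : 𝒪[K], IsLocalRing.residue 𝒪[K] ⟨σ x, hσO x⟩ = (RingHom.id 𝓀[K]) (IsLocalRing.residue 𝒪[K] x) := fun x =>
    residue_eq_of_v_sub_lt_one (hres x x.2)
  obtain ⟨t, ht, htσ⟩ := exists_traceElem_of_v_two_eq_one (σ := σ) h2
  have h2k : (2 : 𝓀[K]) ≠ 0 := by
    rw [show (2 : 𝓀[K]) = IsLocalRing.residue 𝒪[K] 2 from (map_ofNat _ 2).symm, Ne, residue_eq_zero_iff_v_lt_one]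
    exact fun hlt => absurd (show Valued.v (2 : K) < 1 from hlt) (by rw [h2]; exact lt_irrefl 1)
  rw [← Nat.card_coe_set_eq, natCard_neighborSet_root_eq_of_trace hσ hvσ hϖ ⟨t, ht, htσ⟩ hN₁ hσO (RingHom.id _) hσk, Finite.card_option, natCard_conicParams_eq h2k]

/-- **EVERY SELF-DUAL VERTEX OF THE TAME-RAMIFIED `U(3)` TREE HAS EXACTLY `q + 1` NEIGHBOURS** (`q = |𝓀[K]|`): the first half of the `(q+1, q+1)`-regularity of [Tits1979, §2.4] at a ramified place,
in the datum-free lattice model. [cite: Tits1979, §2.4] [cite: BruhatTits1972, §10] [cite: Serre1980Trees, II.1.1] -/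
theorem ncard_neighborSet_of_isSelfDualLattice_of_ramified (hσ : ∀ x, σ (σ x) = x) (hvσ : ∀ a, Valued.v (σ a) = Valued.v a) (hϖ : Valued.v ϖ = WithZero.exp (-1 : ℤ))
    (hres : ∀ x : K, Valued.v x ≤ 1 → Valued.v (σ x - x) < 1) (h2 : Valued.v (2 : K) = 1)
    (hN₁ : IsVertexLattice σ ϖ ((StdForm.antidiagonal 3).over K) 2 (latt (Matrix.diagonal ![(1 : K), 1, ϖ]))) [Finite 𝓀[K]]
    (v : {M : Submodule 𝒪[K] (Fin 3 → K) // IsVertex σ ϖ ((StdForm.antidiagonal 3).over K) M}) (hv : IsSelfDualLattice σ ϖ ((StdForm.antidiagonal 3).over K) v.1) :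
    ((latticeGraph σ ϖ ((StdForm.antidiagonal 3).over K)).neighborSet v).ncard = Nat.card 𝓀[K] + 1 := by
  obtain ⟨t, ht, htσ⟩ := exists_traceElem_of_v_two_eq_one (σ := σ) h2
  rw [ncard_neighborSet_eq_ncard_neighborSet_root_of_trace hσ hvσ hϖ ⟨t, ht, htσ⟩ v hv, ncard_neighborSet_root_of_ramified hσ hvσ hϖ hres h2 hN₁]

end Literature.NumberTheory.Automorphic.UnitaryLatticeTree

end
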